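import Summits.Ventures.CertifiedManyBodySolver.Downfold.EmeryBandEigenvalues
import Summits.Ventures.CertifiedManyBodySolver.Downfold.EmeryFermiFilling
import HarnessLib

/-!
# The conduction band of the four-orbital (d, s, pₓ, p_y) + O–O cuprate model IS the antibonding band of
# the co-shifted σ three-band model — at the eigenvalue level, with no separation hypothesis

Venture CertifiedManyBodySolver, cell `pub/hubbard-downfold` (stage S1, HUMAN RULINGS D-0096/D-0098: the
three-band → one-band reduction error is carried explicitly), seat hubbard-downfold-mod-4 (technique B = band
level); namespace `Summit.Ventures.CertifiedManyBodySolver.Downfold.Emery`. Everything here is PROVED.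
WHAT THIS IS NOT: a statement about any material; `U = 0` band kinematics; the axial level `ε_s` and the
coupling `t_sp` are model inputs, not determined here.

`EmeryAxialFermiSurfaceShape` proved the SECULAR identity `det(H₄ − ε) = −(ε_s − ε)·charCubic(t_pp + a,
t_pp′ + a; ε)`, `a = t_sp²/(ε_s − ε)` (Löwdin elimination of the axial orbital co-shifts both O–O hoppings,
[AndersenEtAl1995, §5]) — an identity of ZERO SETS. The cell's filling / Fermi-surface / van Hove devices
(`EmeryFermiFilling*`, `EmeryVanHove*`) are statements about the OCCUPIED SET `{k : ε_AB(k) ≤ ε}` of the TOP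
σ band; in the four-orbital model the conduction band is the SECOND eigenvalue (the s-like band lies above
`ε_s`, `EmeryBandEigenvalues.le_band4_zero`), and a zero-set identity alone does not say which root is which
(g20 HANDOFF of this seat: «the missing piece … is the band-separation argument for the quartic»). Here it is
supplied WITHOUT any separation hypothesis — a Haynsworth-inertia-type statement proved with the completed
square `EmeryBandEigenvalues.form4_eq` and the tree's Courant–Fischer trial-subspace lemmas:

* §4 `band4_one_gt_of_abBand_gt` / `abBand_gt_of_band4_one_gt` / **`condBand_le_iff`**: for `ε < ε_s`, at
  every `k`, `band4 1 ≤ ε ⟺ abBand Δ t_pd (t_pp + a) (t_pp′ + a) (sx²) (sy²) ≤ ε`, `a = t_sp²/(ε_s − ε)`.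
  Upward: a σ vector with Rayleigh quotient `> ε` and the s unit vector span a plane on which `H₄ − ε` is
  positive definite ⇒ `λ₁ > ε` (max–min). Downward: `ker ℓ` (dim ≥ 3) carries a vector with `λ₁‖y‖² ≤
  ⟨H₄y, y⟩` (min–max); on `ker ℓ` the four-orbital form IS the co-shifted σ form. Also `band4_one_le_abBand`:
  the conduction band never exceeds the UNshifted σ antibonding band (the axial channel only lowers it).
* §5 consequences: the conduction-band occupied set and filling at energy `ε` ARE the σ devices at the
  co-shifted point (`condOccSet_eq_abOccSet`, `condFilling_eq_abFilling`); `condFilling_mono`; the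
  Fermi-energy bracket from two CO-SHIFTED σ filling bounds (`condFermiEnergy_mem_Icc_of_abFilling`); the
  conduction-band Fermi surface is the co-shifted σ = `t–t′` contour (`oneBand_of_band4_one_eq`). Hence every
  certified σ window of the cell (filling ↦ ε_F, FS `t′/t`, x_VH sides) is a four-orbital statement after the
  substitution `(t_pp, t_pp′) ↦ (t_pp + a(ε_F), t_pp′ + a(ε_F))` — ONE scalar, the axial admixture at the
  Fermi level; the census of the admixture the cuprate boxes REQUIRE is `EmeryAxialSlab*`.

Sources: [AndersenEtAl1995, §§5–6, Eqs. (1), (2), (5)]; [PavariniEtAl2001, Eqs. (1)–(3), Fig. 3];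
[HybertsenSchluterChristensen1989, Eq. (1)]; [HornJohnson2013, Thm 4.2.6] via the tree.
-/

noncomputable section

namespace Summit.Ventures.CertifiedManyBodySolver.Downfold.Emery

open Real Matrix WithLp MeasureTheory Set
open scoped InnerProductSpace

/-! ## §4 THE TRANSFER THEOREM: conduction band vs co-shifted σ antibonding band, at the eigenvalue level -/

/-- **TRANSFER, upward**: if the co-shifted σ antibonding band lies above `ε` (`ε < ε_s`), so does the
four-orbital conduction band. Proof: a σ vector `q` with Rayleigh quotient `> ε` and the s unit vector span a
plane on which `H₄ − ε` is positive definite (completed square), so `λ₁(H₄) > ε` by max–min.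
[cite: AndersenEtAl1995, §5]; [cite: HornJohnson2013, Thm 4.2.6] -/
theorem band4_one_gt_of_abBand_gt {Δ εs tpd tpp c tsp sx sy ε : ℝ} (hε : ε < εs)
    (h : ε < abBand Δ tpd (tpp + tsp ^ 2 / (εs - ε)) (c + tsp ^ 2 / (εs - ε)) (sx ^ 2) (sy ^ 2)) :
    ε < band4 Δ εs tpd tpp c tsp sx sy 1 := by
  have hne : ε ≠ εs := ne_of_lt hε
  have hpos : 0 < εs - ε := sub_pos.mpr hε
  set a := tsp ^ 2 / (εs - ε) with ha
  have hH3 := bloch4_isHermitian Δ tpd (tpp + a) (c + a) sx sy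
  have hH4 := fourBandPP_isHermitian Δ εs tpd tpp c tsp sx sy
  -- a σ vector with Rayleigh quotient > ε
  have hT3 : (toEuclideanLin (bloch4 Δ tpd (tpp + a) (c + a) sx sy)).IsSymmetric :=
    isSymmetric_toEuclideanLin_iff.mpr hH3
  obtain ⟨z, -, hz0, hz⟩ := Literature.Analysis.InnerProduct.exists_mem_eigenvalues_mul_le_re_inner hT3
    finrank_euclideanSpace ⟨0, by simp⟩ ⊤ (by simp)
  rw [RCLike.re_to_real, inner_toEuclideanLin_self, norm_sq_eq_dotProduct] at hz
  set q : Fin 3 → ℝ := ofLp z with hq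
  have hq0 : q ≠ 0 := by
    intro h0; apply hz0
    have : ofLp z = 0 := h0
    simpa using congrArg (toLp 2) this
  have hqq : 0 < q ⬝ᵥ q := by
    have hnn : 0 ≤ q ⬝ᵥ q := by
      rw [dotProduct, Fin.sum_univ_three]
      nlinarith [mul_self_nonneg (q 0), mul_self_nonneg (q 1), mul_self_nonneg (q 2)]
    rcases hnn.lt_or_eq with hlt | heq
    · exact hlt
    · exfalso; apply hq0
      have h3 : q 0 * q 0 + q 1 * q 1 + q 2 * q 2 = 0 := by
        rw [dotProduct, Fin.sum_univ_three] at heq; linarith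
      have h0' : q 0 = 0 := by nlinarith [mul_self_nonneg (q 0), mul_self_nonneg (q 1), mul_self_nonneg (q 2)]
      have h1' : q 1 = 0 := by nlinarith [mul_self_nonneg (q 0), mul_self_nonneg (q 1), mul_self_nonneg (q 2)]
      have h2' : q 2 = 0 := by nlinarith [mul_self_nonneg (q 0), mul_self_nonneg (q 1), mul_self_nonneg (q 2)]
      ext i; fin_cases i <;> simp [h0', h1', h2']
  have hz' : ε * (q ⬝ᵥ q) < q ⬝ᵥ (bloch4 Δ tpd (tpp + a) (c + a) sx sy *ᵥ q) := by
    have htop : ε < hH3.eigenvalues₀ ⟨0, by simp⟩ := by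
      have := abBand_eq_band3_zero Δ tpd (tpp + a) (c + a) sx sy
      rw [this] at h; exact h
    change hH3.eigenvalues₀ ⟨0, by simp⟩ * (q ⬝ᵥ q) ≤ q ⬝ᵥ _ at hz
    nlinarith
  -- the plane spanned by the s unit vector and the lifted σ vector
  set s0 : ℝ := -(2 * tsp * (sx * q 1 + sy * q 2) / (εs - ε)) with hs0
  set v : Fin 4 → ℝ := ![q 0, s0, q 1, q 2] with hv
  set es : Fin 4 → ℝ := Pi.single 1 1 with hes
  have hell_v : ellS εs tsp sx sy ε v = 0 := by simp [ellS, hv, hs0]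
  have hell_es : ellS εs tsp sx sy ε es = 1 := by simp [ellS, hes]
  have hdrop_v : dropS v = q := by ext i; fin_cases i <;> simp [dropS, hv]
  have hdrop_es : dropS es = 0 := by ext i; fin_cases i <;> simp [dropS, hes]
  -- positivity of the form on the plane
  have hform : ∀ α β : ℝ, (α • es + β • v) ⬝ᵥ (fourBandPP Δ εs tpd tpp c tsp sx sy *ᵥ (α • es + β • v))
      - ε * ((α • es + β • v) ⬝ᵥ (α • es + β • v)) =
      (εs - ε) * α ^ 2 + β ^ 2 * (q ⬝ᵥ (bloch4 Δ tpd (tpp + a) (c + a) sx sy *ᵥ q) - ε * (q ⬝ᵥ q)) := by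
    intro α β
    rw [form4_eq Δ εs tpd tpp c tsp sx sy ε hne]
    have hl : ellS εs tsp sx sy ε (α • es + β • v) = α := by
      have e1 : ellS εs tsp sx sy ε (α • es + β • v) = α * ellS εs tsp sx sy ε es + β * ellS εs tsp sx sy ε v := by
        simp only [ellS, Pi.add_apply, Pi.smul_apply, smul_eq_mul]; ring
      rw [e1, hell_v, hell_es]; ring
    have hd : dropS (α • es + β • v) = β • q := by
      ext i; fin_cases i <;> simp [dropS, hv, hes]
    rw [hl, hd]
    simp only [Matrix.mulVec_smul, dotProduct_smul, smul_dotProduct, smul_eq_mul]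
    ring
  -- linear independence ⇒ the plane has dimension 2
  set Es : EuclideanSpace ℝ (Fin 4) := toLp 2 es with hEs
  set V : EuclideanSpace ℝ (Fin 4) := toLp 2 v with hV
  have hli : LinearIndependent ℝ ![Es, V] := by
    refine LinearIndependent.pair_iff.mpr fun α β hαβ => ?_
    have hco := congrArg ofLp hαβ
    simp only [ofLp_add, ofLp_smul, hEs, hV, ofLp_zero] at hco
    have hβ : β = 0 := by
      have hd : dropS (α • es + β • v) = β • q := by ext i; fin_cases i <;> simp [dropS, hv, hes]
      rw [hco] at hd
      have : β • q = 0 := by rw [← hd]; ext i; fin_cases i <;> simp [dropS]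
      rcases smul_eq_zero.mp this with h | h
      · exact h
      · exact absurd h hq0
    have hα : α = 0 := by
      have := congrFun hco 1
      simp [hes, hv, hβ] at this
      exact this
    exact ⟨hα, hβ⟩
  set W : Submodule ℝ (EuclideanSpace ℝ (Fin 4)) := Submodule.span ℝ (Set.range ![Es, V]) with hW
  have hWdim : (1 : ℕ) + 1 ≤ Module.finrank ℝ W := by
    rw [hW, finrank_span_eq_card hli]; simp
  have hT4 : (toEuclideanLin (fourBandPP Δ εs tpd tpp c tsp sx sy)).IsSymmetric :=
    isSymmetric_toEuclideanLin_iff.mpr hH4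
  obtain ⟨y, hyW, hy0, hy⟩ := Literature.Analysis.InnerProduct.exists_mem_re_inner_le_eigenvalues_mul hT4
    finrank_euclideanSpace ⟨1, by simp⟩ W hWdim
  rw [RCLike.re_to_real, inner_toEuclideanLin_self, norm_sq_eq_dotProduct] at hy
  change _ ≤ band4 Δ εs tpd tpp c tsp sx sy 1 * _ at hy
  obtain ⟨coef, hcoef⟩ := Submodule.mem_span_range_iff_exists_fun ℝ |>.mp hyW
  have hy_eq : ofLp y = coef 0 • es + coef 1 • v := by
    have := congrArg ofLp hcoef
    simp only [Fin.sum_univ_two, Matrix.cons_val_zero, Matrix.cons_val_one, Matrix.cons_val_fin_one,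
      ofLp_add, ofLp_smul, hEs, hV] at this
    exact this.symm
  by_contra hcon
  push Not at hcon
  have hyy : 0 < ofLp y ⬝ᵥ ofLp y := by
    rw [← norm_sq_eq_dotProduct]; positivity
  have key := hform (coef 0) (coef 1)
  rw [← hy_eq] at key
  have hneg : ofLp y ⬝ᵥ (fourBandPP Δ εs tpd tpp c tsp sx sy *ᵥ ofLp y) - ε * (ofLp y ⬝ᵥ ofLp y) ≤ 0 := by
    nlinarith
  rw [key] at hneg
  have hP : 0 < q ⬝ᵥ (bloch4 Δ tpd (tpp + a) (c + a) sx sy *ᵥ q) - ε * (q ⬝ᵥ q) := by linarith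
  have h1 : 0 ≤ (εs - ε) * coef 0 ^ 2 := mul_nonneg hpos.le (sq_nonneg _)
  have h2 : 0 ≤ coef 1 ^ 2 * (q ⬝ᵥ (bloch4 Δ tpd (tpp + a) (c + a) sx sy *ᵥ q) - ε * (q ⬝ᵥ q)) :=
    mul_nonneg (sq_nonneg _) hP.le
  have hα2 : coef 0 ^ 2 = 0 := (mul_eq_zero.mp (by linarith)).resolve_left hpos.ne'
  have hβ2 : coef 1 ^ 2 = 0 :=
    (mul_eq_zero.mp (show coef 1 ^ 2 * _ = 0 by linarith)).resolve_right hP.ne'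
  have hα0 : coef 0 = 0 := (pow_eq_zero_iff two_ne_zero).mp hα2
  have hβ0 : coef 1 = 0 := (pow_eq_zero_iff two_ne_zero).mp hβ2
  apply hy0
  have : ofLp y = 0 := by rw [hy_eq, hα0, hβ0]; simp
  simpa using congrArg (toLp 2) this

/-- **TRANSFER, downward**: if the four-orbital conduction band lies above `ε` (`ε < ε_s`), so does the
co-shifted σ antibonding band. Proof: `ker ℓ` has dimension ≥ 3, so (min–max) it contains `y ≠ 0` with
`λ₁‖y‖² ≤ ⟨H₄y, y⟩`; on `ker ℓ` the four-orbital form is the co-shifted σ form of `q = dropS y`, whose Rayleigh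
quotient therefore exceeds `ε`. [cite: AndersenEtAl1995, §5]; [cite: HornJohnson2013, Thm 4.2.6] -/
theorem abBand_gt_of_band4_one_gt {Δ εs tpd tpp c tsp sx sy ε : ℝ} (hε : ε < εs)
    (h : ε < band4 Δ εs tpd tpp c tsp sx sy 1) :
    ε < abBand Δ tpd (tpp + tsp ^ 2 / (εs - ε)) (c + tsp ^ 2 / (εs - ε)) (sx ^ 2) (sy ^ 2) := by
  have hne : ε ≠ εs := ne_of_lt hε
  have hH4 := fourBandPP_isHermitian Δ εs tpd tpp c tsp sx sy
  have hT4 : (toEuclideanLin (fourBandPP Δ εs tpd tpp c tsp sx sy)).IsSymmetric :=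
    isSymmetric_toEuclideanLin_iff.mpr hH4
  have hK := three_le_finrank_ker_ellLin εs tsp sx sy ε
  obtain ⟨y, hyK, hy0, hy⟩ := Literature.Analysis.InnerProduct.exists_mem_eigenvalues_mul_le_re_inner hT4
    finrank_euclideanSpace ⟨1, by simp⟩ (LinearMap.ker (ellLin εs tsp sx sy ε)) (by simp; omega)
  rw [RCLike.re_to_real, inner_toEuclideanLin_self, norm_sq_eq_dotProduct] at hy
  change band4 Δ εs tpd tpp c tsp sx sy 1 * _ ≤ _ at hy
  have hℓ : ellS εs tsp sx sy ε (ofLp y) = 0 := LinearMap.mem_ker.mp hyK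
  have hxx : 0 < ofLp y ⬝ᵥ ofLp y := by
    rw [← norm_sq_eq_dotProduct]; exact pow_pos (norm_pos_iff.mpr hy0) 2
  have hform := form4_eq Δ εs tpd tpp c tsp sx sy ε hne (ofLp y)
  rw [hℓ] at hform
  have hpos : 0 < ofLp y ⬝ᵥ (fourBandPP Δ εs tpd tpp c tsp sx sy *ᵥ ofLp y) - ε * (ofLp y ⬝ᵥ ofLp y) := by
    nlinarith
  rw [hform] at hpos
  exact lt_abBand_of_rayleigh (by linarith)

/-- **THE TRANSFER THEOREM.** For `ε < ε_s`, at every `k`: the four-orbital CONDUCTION band (second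
eigenvalue of `fourBandPP`) lies at or below `ε` iff the antibonding band of the σ model with CO-SHIFTED O–O
hoppings `(t_pp + a, t_pp′ + a)`, `a = t_sp²/(ε_s − ε)`, does. No band-separation hypothesis.
[cite: AndersenEtAl1995, §5]; [cite: PavariniEtAl2001, Eqs. (1)–(3)] -/
theorem condBand_le_iff {Δ εs tpd tpp c tsp sx sy ε : ℝ} (hε : ε < εs) :
    band4 Δ εs tpd tpp c tsp sx sy 1 ≤ ε ↔
      abBand Δ tpd (tpp + tsp ^ 2 / (εs - ε)) (c + tsp ^ 2 / (εs - ε)) (sx ^ 2) (sy ^ 2) ≤ ε := by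
  constructor
  · intro h
    by_contra h'
    exact absurd h (not_le.mpr (band4_one_gt_of_abBand_gt hε (not_le.mp h')))
  · intro h
    by_contra h'
    exact absurd h (not_le.mpr (abBand_gt_of_band4_one_gt hε (not_le.mp h')))

/-- THE AXIAL CHANNEL ONLY LOWERS THE CONDUCTION BAND: `band4 1 ≤ ε_AB` (UNshifted σ antibonding band) at
every `k` — min–max on the hyperplane `x_s = 0`, where the four-orbital form is the σ form.
[cite: PavariniEtAl2001, Fig. 3]; [cite: HornJohnson2013, Thm 4.2.6] -/
theorem band4_one_le_abBand (Δ εs tpd tpp c tsp sx sy : ℝ) :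
    band4 Δ εs tpd tpp c tsp sx sy 1 ≤ abBand Δ tpd tpp c (sx ^ 2) (sy ^ 2) := by
  have hH4 := fourBandPP_isHermitian Δ εs tpd tpp c tsp sx sy
  have hT4 : (toEuclideanLin (fourBandPP Δ εs tpd tpp c tsp sx sy)).IsSymmetric :=
    isSymmetric_toEuclideanLin_iff.mpr hH4
  have hK := three_le_finrank_ker_ellLin εs 0 sx sy 0
  change hT4.eigenvalues finrank_euclideanSpace ⟨1, by simp⟩ ≤ _
  refine Literature.Analysis.InnerProduct.eigenvalues_le_of_forall_mem hT4 finrank_euclideanSpace ⟨1, by simp⟩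
    (LinearMap.ker (ellLin εs 0 sx sy 0)) (by simp; omega) fun y hy => ?_
  rw [RCLike.re_to_real, inner_toEuclideanLin_self, norm_sq_eq_dotProduct]
  have hs : ofLp y 1 = 0 := by
    have := LinearMap.mem_ker.mp hy
    simpa [ellLin, ellS] using this
  obtain ⟨h1, h2⟩ := form4_of_s_zero Δ εs tpd tpp c tsp sx sy (ofLp y) hs
  rw [h1, h2]
  exact rayleigh_bloch4_le_abBand Δ tpd tpp c sx sy _

/-- The s-like band is strictly above every `ε < ε_s`; with `condBand_le_iff` this pins the band COUNT:
above such an `ε` there are exactly `1 + #{σˢ bands above ε}` four-orbital bands at the top two levels.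
[cite: AndersenEtAl1995, Eq. (1)] -/
theorem lt_band4_zero {Δ εs tpd tpp c tsp sx sy ε : ℝ} (hε : ε < εs) :
    ε < band4 Δ εs tpd tpp c tsp sx sy 0 :=
  lt_of_lt_of_le hε (le_band4_zero Δ εs tpd tpp c tsp sx sy)

/-! ## §5 Consequences: the σ devices ARE four-orbital devices at the co-shifted point -/

/-- The OCCUPIED SET of the four-orbital conduction band at Fermi energy `ε`, in the quadrant `[0, π]²`.
[cite: AndersenEtAl1995, Eq. (1)] -/
def condOccSet (Δ εs tpd tpp c tsp ε : ℝ) : Set (ℝ × ℝ) :=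
  {k | k ∈ Icc (0 : ℝ) π ×ˢ Icc (0 : ℝ) π ∧
    band4 Δ εs tpd tpp c tsp (Real.sin (k.1 / 2)) (Real.sin (k.2 / 2)) 1 ≤ ε}

/-- THE FILLING of the four-orbital conduction band at Fermi energy `ε`, PER SPIN (Lebesgue fraction of the
quadrant; `n_holes = 1 + x` per CuO₂ ⇔ value `(1 − x)/2`, as for `abFilling`). [cite: AndersenEtAl1995, Eq. (1)] -/
def condFilling (Δ εs tpd tpp c tsp ε : ℝ) : ℝ := (volume (condOccSet Δ εs tpd tpp c tsp ε)).toReal / π ^ 2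

/-- **The conduction-band occupied set IS the co-shifted σ occupied set** (`ε < ε_s`).
[cite: AndersenEtAl1995, §5] -/
theorem condOccSet_eq_abOccSet {Δ εs tpd tpp c tsp ε : ℝ} (hε : ε < εs) :
    condOccSet Δ εs tpd tpp c tsp ε = abOccSet Δ tpd (tpp + tsp ^ 2 / (εs - ε)) (c + tsp ^ 2 / (εs - ε)) ε := by
  ext k
  simp only [condOccSet, abOccSet, Set.mem_setOf_eq, halfSq]
  rw [condBand_le_iff hε]

/-- **The conduction-band filling IS the co-shifted σ filling** (`ε < ε_s`): `condFilling(ε) = abFilling Δ t_pd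
(t_pp + a) (t_pp′ + a) ε`, `a = t_sp²/(ε_s − ε)`. [cite: AndersenEtAl1995, §5] -/
theorem condFilling_eq_abFilling {Δ εs tpd tpp c tsp ε : ℝ} (hε : ε < εs) :
    condFilling Δ εs tpd tpp c tsp ε = abFilling Δ tpd (tpp + tsp ^ 2 / (εs - ε)) (c + tsp ^ 2 / (εs - ε)) ε := by
  unfold condFilling abFilling
  rw [condOccSet_eq_abOccSet hε]

/-- The conduction-band occupied set sits in the quadrant. [folklore] -/
theorem condOccSet_subset_quadrant (Δ εs tpd tpp c tsp ε : ℝ) :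
    condOccSet Δ εs tpd tpp c tsp ε ⊆ Icc (0 : ℝ) π ×ˢ Icc (0 : ℝ) π := fun _ hk => hk.1

/-- … hence has finite measure. [folklore] -/
theorem volume_condOccSet_ne_top (Δ εs tpd tpp c tsp ε : ℝ) : volume (condOccSet Δ εs tpd tpp c tsp ε) ≠ ⊤ := by
  have hle : volume (condOccSet Δ εs tpd tpp c tsp ε) ≤ ENNReal.ofReal (π - 0) * ENNReal.ofReal (π - 0) := by
    rw [← volume_Icc_prod_Icc]
    exact measure_mono (condOccSet_subset_quadrant Δ εs tpd tpp c tsp ε)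
  exact ne_top_of_le_ne_top (ENNReal.mul_ne_top ENNReal.ofReal_ne_top ENNReal.ofReal_ne_top) hle

/-- THE CONDUCTION-BAND FILLING IS MONOTONE IN THE FERMI ENERGY (at fixed four-orbital parameters; note that
the co-shifted σ parameters on the right of `condFilling_eq_abFilling` move with `ε`). [folklore] -/
theorem condFilling_mono (Δ εs tpd tpp c tsp : ℝ) {ε₁ ε₂ : ℝ} (h : ε₁ ≤ ε₂) :
    condFilling Δ εs tpd tpp c tsp ε₁ ≤ condFilling Δ εs tpd tpp c tsp ε₂ := by
  unfold condFilling
  refine div_le_div_of_nonneg_right ?_ (by positivity)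
  refine ENNReal.toReal_mono (volume_condOccSet_ne_top Δ εs tpd tpp c tsp ε₂) (measure_mono ?_)
  intro k hk
  exact ⟨hk.1, hk.2.trans h⟩

/-- FERMI-ENERGY BRACKET for the four-orbital conduction band from two conduction-band filling bounds.
[folklore] -/
theorem condFermiEnergy_mem_Icc {Δ εs tpd tpp c tsp ε ε₁ ε₂ ν₁ ν₂ u l : ℝ}
    (h₁ : condFilling Δ εs tpd tpp c tsp ε₁ ≤ u) (hu : u < ν₁) (h₂ : l ≤ condFilling Δ εs tpd tpp c tsp ε₂)
    (hl : ν₂ < l) (hν : condFilling Δ εs tpd tpp c tsp ε ∈ Set.Icc ν₁ ν₂) : ε ∈ Set.Icc ε₁ ε₂ := by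
  obtain ⟨hlo, hhi⟩ := hν
  constructor
  · by_contra h
    have := condFilling_mono Δ εs tpd tpp c tsp (le_of_not_ge h)
    linarith
  · by_contra h
    have := condFilling_mono Δ εs tpd tpp c tsp (le_of_not_ge h)
    linarith

/-- **FERMI-ENERGY BRACKET FROM TWO CO-SHIFTED σ CERTIFICATES**: an upper filling bound for the σ model
co-shifted by `a(ε₁)` at `ε₁` and a lower one for the σ model co-shifted by `a(ε₂)` at `ε₂` (both below `ε_s`)
bracket the four-orbital Fermi energy — the cell's kernel-decided `abFilling` counts (`EmeryFermiFillingCount`)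
apply verbatim at the shifted parameters. [cite: AndersenEtAl1995, §5] -/
theorem condFermiEnergy_mem_Icc_of_abFilling {Δ εs tpd tpp c tsp ε ε₁ ε₂ ν₁ ν₂ u l : ℝ}
    (hε₁ : ε₁ < εs) (hε₂ : ε₂ < εs)
    (h₁ : abFilling Δ tpd (tpp + tsp ^ 2 / (εs - ε₁)) (c + tsp ^ 2 / (εs - ε₁)) ε₁ ≤ u) (hu : u < ν₁)
    (h₂ : l ≤ abFilling Δ tpd (tpp + tsp ^ 2 / (εs - ε₂)) (c + tsp ^ 2 / (εs - ε₂)) ε₂) (hl : ν₂ < l)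
    (hν : condFilling Δ εs tpd tpp c tsp ε ∈ Set.Icc ν₁ ν₂) : ε ∈ Set.Icc ε₁ ε₂ :=
  condFermiEnergy_mem_Icc (by rwa [condFilling_eq_abFilling hε₁]) hu
    (by rwa [condFilling_eq_abFilling hε₂]) hl hν

/-- THE CONDUCTION-BAND FERMI SURFACE IS THE CO-SHIFTED `t–t′` CONTOUR: if `band4 1 = ε` at `k = (kx, ky)`
(`ε ≠ ε_s`) then `k` lies on the constant-energy contour of the pure `t–t′` one-band form with the co-shifted
weights (`EmeryAxialFermiSurfaceShape.det_fourBandPP_eq_zero_iff_oneBand`), i.e. `t′/t = fsRatio Δ t_pd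
(t_pp + a) (t_pp′ + a) ε`. [cite: AndersenEtAl1995, §6]; [cite: PavariniEtAl2001, Eqs. (1)–(3)] -/
theorem oneBand_of_band4_one_eq {Δ εs tpd tpp c tsp kx ky ε : ℝ} (γ : ℝ) (hε : ε ≠ εs)
    (h : band4 Δ εs tpd tpp c tsp (Real.sin (kx / 2)) (Real.sin (ky / 2)) 1 = ε) :
    oneBand γ (fsT Δ tpd (tpp + tsp ^ 2 / (εs - ε)) (c + tsp ^ 2 / (εs - ε)) ε)
        (fsTp tpd (tpp + tsp ^ 2 / (εs - ε)) (c + tsp ^ 2 / (εs - ε)) ε) 0 kx ky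
      = γ - 4 * fsT Δ tpd (tpp + tsp ^ 2 / (εs - ε)) (c + tsp ^ 2 / (εs - ε)) ε
          - 4 * fsTp tpd (tpp + tsp ^ 2 / (εs - ε)) (c + tsp ^ 2 / (εs - ε)) ε + cA Δ ε :=
  (det_fourBandPP_eq_zero_iff_oneBand Δ εs tpd tpp c tsp kx ky ε γ hε).mp
    ((det_fourBandPP_sub_eq_zero_iff_band4 Δ εs tpd tpp c tsp _ _ ε).mpr ⟨1, h⟩)

end Summit.Ventures.CertifiedManyBodySolver.Downfold.Emery
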